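import Summits.QuantumFields.BalabanUV.T4Continuum.Support.NE9TreeBlockChain
import Summits.QuantumFields.BalabanUV.T4Continuum.Support.NE9TorusSizeDichotomy
import Literature.Probability.LatticeModels.LatticeAnimals

/-!
# NE9TorusIneq126Chain — the BLOCK-CHAIN COUNT of the torus localization domains of linear size `< n` through a cube:
# `#{Ȳ ∋ c̄ : d_j(Ȳ) < n} ≤ 2^d·(3^d+1)^{2(4n−2)}·2^{2^d(4n−1)} ≤ 2^d·Γ^{4n−1}`, `Γ = 2^(2^d)·(3^d+1)²`, and the constants `Γ`, `κ₁ = 4·log Γ` of the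
# direct (1.26) (cell `pub-balaban`, T4-DAG §2 node U3 / §6 rows NE9 ∕ NE5; NE9 formalisation swarm LEAF PROVER 05, lineage leaf-05, generation 4;
# part B1 of the lineage item «(1.26) direct on the torus model by a block-chain discretisation» — part A `NE9TreeBlockChain` (p212919),
# part B2 `NE9TorusIneq126ChainSum` = the shell sum, the `Ineq126` socket and the numerals)

HONEST FRAMING (T4-DAG PAGE 1).  Rung (B)+1 of the FINITE-VOLUME T⁴ programme — existence AND uniqueness of the ε → 0 limit of
gauge-invariant observables on a fixed torus; NOT infinite volume, NOT a mass gap, NOT the Clay problem.  NE9 (`T4OutputRate.NE9` ∧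
`FadingMemory`) is a cell NEW ESTIMATE, NOT PRINTED, and is NOT discharged here («NE9 ⇐ the named binders»); spine 0/9 unchanged; 0/18
leaves instantiated on Bałaban's objects.  HONEST DEPENDENCY (cell line, verbatim): continuum YM on T⁴ ⇐ BetaPertH ∧ nine spine estimates
(0/9 proved); BetaPertH ⇐ (D1) ∧ (D4) ∧ CAP+tail; G-an2-4 gates asym, D1 and NE2/3/4.  `FlowStep.BetaPertH`, (B), (B^μ) do not occur here.
[II] = [Balaban1988RG2Cluster] and [I] = [Balaban1987RG1] are quoted for TYPES only (ABSOLUTE RULE: nothing printed in the audited series is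
asserted); the objects are the cell's MODEL of `d_j` (`TreeLengthTorus.torusTreeLen`, reading D-pv22g2.1, sup-metric convention D-pv22.1 (i)).

THE LOCATED POINT (FINDING F-ne9leaf05g3-1, census class).  Unit pv03's route to (1.26) (`B12TreeDecay.ineq126_of_volumeLeaf`, on the torus
`TreeLengthTorus.ineq126_torus`, on the carriers of record NE5-P2's `B13DomainGeometryTR.ineq126_level`) is `e^{−κd} ≤ e^{κ}·e^{−(κ/c₀)|X|}`
+ the lazy-walk animal count at `c₀ = 4·2^d`, `Δ = 2d`: threshold `c₀·log(2(Δ+1)²) = 64·log 162 ≈ 325.6`, constant `e^{κ₀}/81 = 162⁶⁴/81`.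
A DIRECT count needs the structure of the admissible graph; part A turned it into a king-connected chain of `≤ 4n − 1` blocks.  THIS FILE
(two data `def`s — the constants `chainConst d = Γ_d`, `kappa₁ d = 4·log Γ_d` — no `def … : Prop`, 0 sorry):
* §0 the constants, `e^{−κm}·Γ^{4m} = (e^{−(κ−κ₁)})^m`, and the numeral `Γ_4 = 2¹⁶·82² = 440 664 064`;
* §1 `exists_chainData`: a torus localization domain `Ȳ ∋ c̄` with `d_j(Ȳ) < n` is the projection of a family of cubes of `ℤ^d` lying in the
  blocks of a king-connected chain of `≤ 4n − 1` corners anchored at `natLift c̄` (re-sheeting `TreeLengthTorusGeometry.exists_translate_meets`,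
  part A `NE9TreeBlockChain.exists_blockChain` BY NAME);
* §2 **the count** `card_filter_torusTreeLen_lt_le`: over any catalogue `S` of torus localization domains,
  `#{Ȳ ∈ S : Ȳ ∋ c̄, d_j(Ȳ) < n} ≤ 2^d·(3^d+1)^{2(4n−2)}·2^{2^d(4n−1)}` (`2^d` anchors; chains through an anchor by
  `LatticeAnimals.card_connectedFamily_le` at `Δ = 3^d`; subsets of the blocks, `2^{2^d}` per block; `Ȳ` determined by the subset), and the
  closed form `card_filter_torusTreeLen_lt_le_pow`: `≤ 2^d·Γ^{4n−1}`.
DISGUISE TEST: lattice ∕ continuum geometry of the cell's MODEL of `d_j` and counting; no activity, no history — not NE9, not NE5.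

References (TYPES only): T. Bałaban, *Renormalization group approach to lattice gauge field theories. II. Cluster expansions*, Commun.
Math. Phys. **116**, 1–22 (1988) [Balaban1988RG2Cluster], (1.26) p. 8; T. Bałaban, *… I*, Commun. Math. Phys. **109**, 249–301 (1987)
[Balaban1987RG1], p. 257 (the linear size d_j); S. Friedli, Y. Velenik, *Statistical Mechanics of Lattice Systems*, CUP 2017, Lemma 3.38 ∕
(5.27) [FriedliVelenik2017] (the lazy-walk animal count, tree module `LatticeAnimals`).  Summits-side NEW work (LEAN PLACEMENT RULE); imports
part A, part 1 (`NE9TorusSizeDichotomy`) and `Literature.Probability.LatticeModels.LatticeAnimals` only; modifies nothing.  Value = kernel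
counting for the cell's census, NOT summit progress.
-/


noncomputable section

open scoped BigOperators

namespace Summit.QuantumFields.BalabanUV.T4Continuum.NE9TorusIneq126Chain

open Literature.MathematicalPhysics.QuantumFieldTheory.Balaban1983to89
open Literature.MathematicalPhysics.QuantumFieldTheory.Balaban1983to89.B13ScaleTransfer (Pt)
open Literature.MathematicalPhysics.QuantumFieldTheory.Balaban1983to89.TreeLength
open Literature.MathematicalPhysics.QuantumFieldTheory.Balaban1983to89.TreeLengthTorus
open Literature.MathematicalPhysics.QuantumFieldTheory.Balaban1983to89.TreeLengthTorusGeometry (exists_translate_meets)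
open Literature.MathematicalPhysics.QuantumFieldTheory.Balaban1983to89.B13FamilySum (Ineq126)
open Literature.Probability.LatticeModels (card_connectedFamily_le)
open Summit.QuantumFields.BalabanUV.T4Continuum.NE9TreeBlockChain (exists_blockChain)
open Summit.QuantumFields.BalabanUV.T4Continuum.NE9TorusSizeDichotomy
  (torusTreeLen_dichotomy card_filter_torusTreeLen_eq_zero_le)

variable {d N : ℕ}

/-! ## §0 The two constants -/

/-- The per-block entropy constant of the block-chain count, `Γ_d := 2^(2^d)·(3^d + 1)²` (subsets of one block of `2^d` cubes times the
lazy-walk price `(Δ+1)²` of one king step, `Δ = 3^d`); `Γ_4 = 2¹⁶·82² = 440 664 064` (§5). [folklore] -/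
def chainConst (d : ℕ) : ℝ := 2 ^ (2 ^ d) * (3 ^ d + 1) ^ 2

/-- The block-chain threshold of (1.26) on the torus model, `κ₁(d) := 4·log Γ_d` (four blocks per unit of sup-length); `79 < κ₁(4) < 80` (§5).
[folklore] -/
def kappa₁ (d : ℕ) : ℝ := 4 * Real.log (chainConst d)

/-- `Γ_d ≥ 8 > 1`. [folklore] -/
theorem one_lt_chainConst (d : ℕ) : 1 < chainConst d := by
  unfold chainConst
  have h1 : (2 : ℝ) ≤ 2 ^ (2 ^ d) := by
    calc (2 : ℝ) = 2 ^ 1 := by norm_num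
      _ ≤ 2 ^ (2 ^ d) := pow_le_pow_right₀ (by norm_num) Nat.one_le_two_pow
  have h2 : (4 : ℝ) ≤ (3 ^ d + 1) ^ 2 := by
    have : (1 : ℝ) ≤ 3 ^ d := one_le_pow₀ (by norm_num)
    nlinarith
  nlinarith

/-- `Γ_d > 0`. [folklore] -/
theorem chainConst_pos (d : ℕ) : 0 < chainConst d := zero_lt_one.trans (one_lt_chainConst d)

/-- `κ₁(d) > 0`. [folklore] -/
theorem kappa₁_pos (d : ℕ) : 0 < kappa₁ d := by
  unfold kappa₁
  have := Real.log_pos (one_lt_chainConst d)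
  positivity

/-- `e^{κ₁} = Γ⁴`, i.e. `e^{−κm}·Γ^{4m} = (e^{−(κ−κ₁)})^m` for every `m`. [folklore] -/
theorem exp_neg_mul_mul_pow (d : ℕ) (κ : ℝ) (m : ℕ) :
    Real.exp (-(κ * m)) * chainConst d ^ (4 * m) = Real.exp (-(κ - kappa₁ d)) ^ m := by
  rw [← Real.exp_nat_mul, kappa₁]
  have h : (m : ℝ) * -(κ - 4 * Real.log (chainConst d)) = -(κ * m) + ((4 * m : ℕ) : ℝ) * Real.log (chainConst d) := by
    push_cast
    ring
  rw [h, Real.exp_add, Real.exp_nat_mul, Real.exp_log (chainConst_pos d)]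

/-! ## §1 Per-domain data: a domain of linear size `< n` through `c̄` projects from a subset of an anchored block chain -/

/-- If `d_j(X̄) < a` and `X̄` has an admissible graph at all, it has one of length `< a`. [folklore] -/
theorem exists_tAdmissible_len_lt {X : Finset (TPt d N)} (hne : ∃ T, TAdmissible X T) {a : ℝ} (h : torusTreeLen X < a) :
    ∃ T, TAdmissible X T ∧ len T < a := by
  obtain ⟨T₀, hT₀⟩ := hne
  obtain ⟨ℓ, ⟨T, hT, rfl⟩, hℓ⟩ := exists_lt_of_csInf_lt (s := tlengths X) ⟨len T₀, T₀, hT₀, rfl⟩ h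
  exact ⟨T, hT, hℓ⟩

/-- **CHAIN DATA OF A SMALL DOMAIN.**  A torus localization domain `Ȳ ∋ c̄` (non-empty, torus-face-connected, `N ≥ 1`) with `d_j(Ȳ) < n`
(`n ≥ 1`) is the projection `Ȳ = proj(B)` of a family `B ⊂ ℤ^d` of cubes each lying in a block `a + {0,1}^d` of a king-connected family `A` of
`≤ 4n − 1` corners, one of whose blocks contains `natLift c̄` (an admissible graph of length `< n`, re-sheeted through `natLift c̄` by
`exists_translate_meets`; its met lifts; part A `exists_blockChain`). [folklore] -/
theorem exists_chainData [NeZero N] {Y : Finset (TPt d N)} (hYne : Y.Nonempty) (hYc : TFaceConnected Y) {c : TPt d N}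
    (hcY : c ∈ Y) {n : ℕ} (hn : 1 ≤ n) (hYn : torusTreeLen Y < n) :
    ∃ A : Finset (Pt d), ∃ a₀ ∈ A, ∃ B : Finset (Pt d),
      (∀ μ, natLift c μ = a₀ μ ∨ natLift c μ = a₀ μ + 1) ∧ A.card ≤ 4 * n - 1 ∧
      (∀ a ∈ A, Relation.ReflTransGen
        (fun a b : Pt d => (∀ μ, a μ - 1 ≤ b μ ∧ b μ ≤ a μ + 1) ∧ a ∈ A ∧ b ∈ A) a₀ a) ∧
      (∀ x ∈ B, ∃ a ∈ A, ∀ μ, x μ = a μ ∨ x μ = a μ + 1) ∧ Y = B.image (proj N) := by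
  classical
  obtain ⟨T₀, hT₀, -⟩ := exists_tAdmissible hYne hYc
  obtain ⟨T₁, hT₁, hlt₁⟩ := exists_tAdmissible_len_lt ⟨T₀, hT₀⟩ hYn
  obtain ⟨T, hT, hlenT, hmeet⟩ := exists_translate_meets hT₁ hcY (proj_natLift c)
  have hlt : len T < n := hlenT ▸ hlt₁
  obtain ⟨A, a₀, ha₀, hx₀, hcard, hconn, hblk⟩ := exists_blockChain hT.connected.isPreconnected hn hlt hmeet
  choose! f hfproj hfmeets using hT.meets
  refine ⟨A, a₀, ha₀, Y.image f, hx₀, hcard, hconn, ?_, ?_⟩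
  · intro x hx
    obtain ⟨a, ha, rfl⟩ := Finset.mem_image.1 hx
    exact hblk (f a) (hfmeets a ha)
  · ext a
    constructor
    · intro ha
      exact Finset.mem_image.2 ⟨f a, Finset.mem_image_of_mem f ha, hfproj a ha⟩
    · intro ha
      obtain ⟨x, hx, rfl⟩ := Finset.mem_image.1 ha
      obtain ⟨a', ha', rfl⟩ := Finset.mem_image.1 hx
      rw [hfproj a' ha']
      exact ha'

/-! ## §2 The count of the domains of linear size `< n` through a cube -/

/-- **THE BLOCK-CHAIN COUNT.**  In any catalogue `S` of torus localization domains (non-empty, torus-face-connected families of cubes of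
`(ℤ/N)^d`, `N ≥ 1`), for every cube `c̄` and every integer `n ≥ 1`:
`#{Ȳ ∈ S : Ȳ ∋ c̄, d_j(Ȳ) < n} ≤ 2^d · (3^d+1)^{2(4n−2)} · 2^{2^d(4n−1)}` — `2^d` anchors, at most `(3^d+1)^{2(4n−2)}` king-connected chains of
`≤ 4n − 1` corners through an anchor (`LatticeAnimals.card_connectedFamily_le`, `Δ = 3^d`), at most `2^{2^d(4n−1)}` subsets of their blocks,
and `Ȳ` is determined by the subset (§1). [folklore] -/
theorem card_filter_torusTreeLen_lt_le [NeZero N] (S : Finset (Finset (TPt d N)))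
    (hS : ∀ Y ∈ S, Y.Nonempty ∧ TFaceConnected Y) (c : TPt d N) {n : ℕ} (hn : 1 ≤ n) :
    (S.filter fun Y => c ∈ Y ∧ torusTreeLen Y < n).card
      ≤ 2 ^ d * ((3 ^ d + 1) ^ (2 * (4 * n - 2)) * 2 ^ (2 ^ d * (4 * n - 1))) := by
  classical
  set F := S.filter fun Y => c ∈ Y ∧ torusTreeLen Y < n with hF
  set K := 4 * n - 1 with hK
  -- §1 data for every member of `F`
  have hdata : ∀ Y ∈ F, ∃ A : Finset (Pt d), ∃ a₀ ∈ A, ∃ B : Finset (Pt d),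
      (∀ μ, natLift c μ = a₀ μ ∨ natLift c μ = a₀ μ + 1) ∧ A.card ≤ 4 * n - 1 ∧
      (∀ a ∈ A, Relation.ReflTransGen
        (fun a b : Pt d => (∀ μ, a μ - 1 ≤ b μ ∧ b μ ≤ a μ + 1) ∧ a ∈ A ∧ b ∈ A) a₀ a) ∧
      (∀ x ∈ B, ∃ a ∈ A, ∀ μ, x μ = a μ ∨ x μ = a μ + 1) ∧ Y = B.image (proj N) := by
    intro Y hY
    rw [hF, Finset.mem_filter] at hY
    exact exists_chainData (hS Y hY.1).1 (hS Y hY.1).2 hY.2.1 hn hY.2.2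
  choose! Ad a0 ha0 Bd hanc hcardA hconn hblk hYB using hdata
  -- the anchors
  set M : Finset (Pt d) := Fintype.piFinset fun μ => ({natLift c μ - 1, natLift c μ} : Finset ℤ) with hM
  have ha0M : ∀ Y ∈ F, a0 Y ∈ M := by
    intro Y hY
    rw [hM, Fintype.mem_piFinset]
    intro μ
    rw [Finset.mem_insert, Finset.mem_singleton]
    rcases hanc Y hY μ with h | h <;> omega
  have hMcard : M.card ≤ 2 ^ d := by
    rw [hM, Fintype.card_piFinset]
    calc ∏ μ, ({natLift c μ - 1, natLift c μ} : Finset ℤ).card ≤ ∏ _μ : Fin d, 2 :=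
          Finset.prod_le_prod' fun μ _ => Finset.card_le_two
      _ = 2 ^ d := by rw [Finset.prod_const, Finset.card_univ, Fintype.card_fin]
  -- the blocks of a chain
  let U : Finset (Pt d) → Finset (Pt d) := fun A =>
    A.biUnion fun a => Fintype.piFinset fun μ => ({a μ, a μ + 1} : Finset ℤ)
  have hBU : ∀ Y ∈ F, Bd Y ⊆ U (Ad Y) := by
    intro Y hY x hx
    obtain ⟨a, ha, hxa⟩ := hblk Y hY x hx
    refine Finset.mem_biUnion.2 ⟨a, ha, Fintype.mem_piFinset.2 fun μ => ?_⟩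
    rw [Finset.mem_insert, Finset.mem_singleton]
    exact hxa μ
  have hUcard : ∀ A : Finset (Pt d), (U A).card ≤ 2 ^ d * A.card := by
    intro A
    calc (U A).card ≤ ∑ a ∈ A, (Fintype.piFinset fun μ => ({a μ, a μ + 1} : Finset ℤ)).card := Finset.card_biUnion_le
      _ ≤ ∑ _a ∈ A, 2 ^ d := Finset.sum_le_sum fun a _ => by
          rw [Fintype.card_piFinset]
          calc ∏ μ, ({a μ, a μ + 1} : Finset ℤ).card ≤ ∏ _μ : Fin d, 2 :=
                Finset.prod_le_prod' fun μ _ => Finset.card_le_two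
            _ = 2 ^ d := by rw [Finset.prod_const, Finset.card_univ, Fintype.card_fin]
      _ = 2 ^ d * A.card := by rw [Finset.sum_const, smul_eq_mul, mul_comm]
  -- the king neighbourhoods (for the animal count)
  let nbr : Pt d → Finset (Pt d) := fun a => Fintype.piFinset fun μ => ({a μ - 1, a μ, a μ + 1} : Finset ℤ)
  have hnbr : ∀ a b : Pt d, (∀ μ, a μ - 1 ≤ b μ ∧ b μ ≤ a μ + 1) → b ∈ nbr a := by
    intro a b h
    rw [Fintype.mem_piFinset]
    intro μ
    have := h μ
    rw [Finset.mem_insert, Finset.mem_insert, Finset.mem_singleton]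
    omega
  have hΔ : ∀ a : Pt d, (nbr a).card ≤ 3 ^ d := by
    intro a
    rw [Fintype.card_piFinset]
    calc ∏ μ, ({a μ - 1, a μ, a μ + 1} : Finset ℤ).card ≤ ∏ _μ : Fin d, 3 :=
          Finset.prod_le_prod' fun μ _ => Finset.card_le_three
      _ = 3 ^ d := by rw [Finset.prod_const, Finset.card_univ, Fintype.card_fin]
  have hsymm : ∀ a b : Pt d, (∀ μ, a μ - 1 ≤ b μ ∧ b μ ≤ a μ + 1) → (∀ μ, b μ - 1 ≤ a μ ∧ a μ ≤ b μ + 1) := by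
    intro a b h μ
    have := h μ
    omega
  -- the fibre over an anchor and a chain injects into the subsets of the blocks
  have hfibre : ∀ a : Pt d, ∀ A : Finset (Pt d), A.card ≤ K →
      ((F.filter fun Y => a0 Y = a).filter fun Y => Ad Y = A).card ≤ 2 ^ (2 ^ d * K) := by
    intro a A hA
    calc ((F.filter fun Y => a0 Y = a).filter fun Y => Ad Y = A).card ≤ (U A).powerset.card := by
          refine Finset.card_le_card_of_injOn Bd ?_ ?_
          · intro Y hY
            have hY1 := Finset.mem_filter.1 (Finset.mem_coe.1 hY)
            have hYF : Y ∈ F := (Finset.mem_filter.1 hY1.1).1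
            rw [Finset.mem_coe, Finset.mem_powerset, ← hY1.2]
            exact hBU Y hYF
          · intro Y hY Y' hY' hBB
            have hYF : Y ∈ F := (Finset.mem_filter.1 (Finset.mem_filter.1 (Finset.mem_coe.1 hY)).1).1
            have hY'F : Y' ∈ F := (Finset.mem_filter.1 (Finset.mem_filter.1 (Finset.mem_coe.1 hY')).1).1
            rw [hYB Y hYF, hYB Y' hY'F, hBB]
      _ = 2 ^ (U A).card := Finset.card_powerset _
      _ ≤ 2 ^ (2 ^ d * K) := Nat.pow_le_pow_right (by norm_num) ((hUcard A).trans (Nat.mul_le_mul_left _ hA))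
  -- the chains through an anchor are few
  have hchains : ∀ a : Pt d, ((F.filter fun Y => a0 Y = a).image Ad).card ≤ (3 ^ d + 1) ^ (2 * (K - 1)) := by
    intro a
    refine card_connectedFamily_le (R := fun a b : Pt d => ∀ μ, a μ - 1 ≤ b μ ∧ b μ ≤ a μ + 1)
      hsymm hΔ hnbr a (K - 1) _ ?_
    intro A hA
    obtain ⟨Y, hY, rfl⟩ := Finset.mem_image.1 hA
    obtain ⟨hYF, hYa⟩ := Finset.mem_filter.1 hY
    refine ⟨hYa ▸ ha0 Y hYF, ?_, fun w hw => hYa ▸ hconn Y hYF w hw⟩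
    have := hcardA Y hYF
    omega
  -- assemble: sum over anchors, then over chains, then the fibres
  have hstep : ∀ a : Pt d, (F.filter fun Y => a0 Y = a).card ≤ (3 ^ d + 1) ^ (2 * (K - 1)) * 2 ^ (2 ^ d * K) := by
    intro a
    rw [Finset.card_eq_sum_card_fiberwise (f := Ad) (t := (F.filter fun Y => a0 Y = a).image Ad)
      fun Y hY => Finset.mem_image_of_mem Ad hY]
    calc ∑ A ∈ (F.filter fun Y => a0 Y = a).image Ad, ((F.filter fun Y => a0 Y = a).filter fun Y => Ad Y = A).card
        ≤ ∑ _A ∈ (F.filter fun Y => a0 Y = a).image Ad, 2 ^ (2 ^ d * K) := by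
          refine Finset.sum_le_sum fun A hA => hfibre a A ?_
          obtain ⟨Y, hY, rfl⟩ := Finset.mem_image.1 hA
          exact hcardA Y (Finset.mem_filter.1 hY).1
      _ = ((F.filter fun Y => a0 Y = a).image Ad).card * 2 ^ (2 ^ d * K) := by rw [Finset.sum_const, smul_eq_mul]
      _ ≤ (3 ^ d + 1) ^ (2 * (K - 1)) * 2 ^ (2 ^ d * K) := Nat.mul_le_mul_right _ (hchains a)
  have hK1 : K - 1 = 4 * n - 2 := by omega
  rw [Finset.card_eq_sum_card_fiberwise (f := a0) (t := M) ha0M]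
  calc ∑ a ∈ M, (F.filter fun Y => a0 Y = a).card ≤ ∑ _a ∈ M, (3 ^ d + 1) ^ (2 * (K - 1)) * 2 ^ (2 ^ d * K) :=
        Finset.sum_le_sum fun a _ => hstep a
    _ = M.card * ((3 ^ d + 1) ^ (2 * (K - 1)) * 2 ^ (2 ^ d * K)) := by rw [Finset.sum_const, smul_eq_mul]
    _ ≤ 2 ^ d * ((3 ^ d + 1) ^ (2 * (4 * n - 2)) * 2 ^ (2 ^ d * (4 * n - 1))) := by
        rw [hK1]
        exact Nat.mul_le_mul_right _ hMcard

/-- The count in the closed form `#{Ȳ ∈ S : Ȳ ∋ c̄, d_j(Ȳ) < n} ≤ 2^d·Γ^{4n−1}`, `Γ = 2^(2^d)·(3^d+1)²`. [folklore] -/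
theorem card_filter_torusTreeLen_lt_le_pow [NeZero N] (S : Finset (Finset (TPt d N)))
    (hS : ∀ Y ∈ S, Y.Nonempty ∧ TFaceConnected Y) (c : TPt d N) {n : ℕ} (hn : 1 ≤ n) :
    ((S.filter fun Y => c ∈ Y ∧ torusTreeLen Y < n).card : ℝ) ≤ 2 ^ d * chainConst d ^ (4 * n - 1) := by
  have h := card_filter_torusTreeLen_lt_le S hS c hn
  have h' : ((S.filter fun Y => c ∈ Y ∧ torusTreeLen Y < n).card : ℝ)
      ≤ 2 ^ d * ((3 ^ d + 1) ^ (2 * (4 * n - 2)) * 2 ^ (2 ^ d * (4 * n - 1))) := by exact_mod_cast h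
  refine h'.trans ?_
  unfold chainConst
  rw [mul_pow, ← pow_mul, ← pow_mul]
  have h3 : ((3 : ℝ) ^ d + 1) ^ (2 * (4 * n - 2)) ≤ (3 ^ d + 1) ^ (2 * (4 * n - 1)) :=
    pow_le_pow_right₀ (by linarith [pow_nonneg (by norm_num : (0 : ℝ) ≤ 3) d]) (by omega)
  have h2 : (0 : ℝ) ≤ 2 ^ (2 ^ d * (4 * n - 1)) := by positivity
  calc (2 : ℝ) ^ d * ((3 ^ d + 1) ^ (2 * (4 * n - 2)) * 2 ^ (2 ^ d * (4 * n - 1)))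
      ≤ 2 ^ d * ((3 ^ d + 1) ^ (2 * (4 * n - 1)) * 2 ^ (2 ^ d * (4 * n - 1))) := by gcongr
    _ = 2 ^ d * (2 ^ (2 ^ d * (4 * n - 1)) * (3 ^ d + 1) ^ (2 * (4 * n - 1))) := by ring

/-- `Γ_4 = 2¹⁶·82² = 440 664 064`. [folklore] -/
theorem chainConst_four : chainConst 4 = 440664064 := by
  unfold chainConst
  norm_num

end Summit.QuantumFields.BalabanUV.T4Continuum.NE9TorusIneq126Chain

end
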